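import Summits.AtomisticToContinuum.HydrodynamicLimit.Theorems.CollisionIsometryCLTAdaptedWeightCLTSAWindowOrbit

/-!
# Stub `stub_windowOfUI` of the line `sustained-anisotropy-superexp` (file 4/4: probability and assembly)
(crux `CollisionIsometryCLT.AdaptedWeightCLT`, stmt-AtomisticToContinuum-14868; `--supports`)

FROM KINETIC WINDOWS TO THE HORIZON, GIVEN THE UI BOUND. Registered stub `stub_windowOfUI` (the reshaped
`WindowOfUIStub` of the line lead): if the sustained-anisotropy events `susEvent(t')` (window-averaged cell
anisotropy `≥ a`, window ipr `≤ ε`, window-local exponential moment `≤ Cw`) have local-Gibbs probability `→ 0`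
uniformly in the window end `t' ≥ Δ_N` (for every `a, λ, Cw`, with some `ε`), then the cell part
`CellInt = ∫₀ᵗ ∫ₓ cellA` of the crux functional tends to `0` in probability, using H1 (`DiffuseAt`), H2 (`TailsOn`)
and the uniform-integrability bound `CellUIBound`.

Proof (files 1–3 supply the deterministic estimate, the measurability, Markov for the ipr and DCT). Fix `κ > 0`; `λ, Cexp` from
`TailsOn`, `C' = max Cexp 1`, `K₁ ≥ 0, N₀` from `CellUIBound`. Choose the cut-off `V` with `3 β C' ≤ κ/8`
(`β = cβ K₁ λ V → 0`), the tail cap `Cw` with `A C'/Cw ≤ κ/8` (`A = cA K₁ V`), the level `a = κ/(8t)`, then `ε`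
from the hypothesis, and `Amax = A + β Cw + 1`, `c₀ = κ/(2 Amax)`. For `N ≥ N₀` with `Δ_N ≤ t`,
`2 A Δ_N ≤ κ/8`, on a good datum with `∫₀ᵗ M ≤ C'` the orbit estimate `cellInt_le_orbit` gives
`CellInt ≤ κ/2 + (A + β Cw) L(z)`, `L(z) = λ{t' ∈ [Δ_N, t] | (t', z) ∈ badSet}`; so
`{κ < CellInt} ⊆ goodᶜ ∪ {C' < ∫₀ᵗ M} ∪ {c₀ ≤ L}`, and
`P{κ < CellInt} ≤ 0 + P{C' < ∫M} + E[L]/c₀` (Markov), `E[L] = ∫_{[Δ_N,t]} P{z | (t', z) ∈ badSet} dt'` (Tonelli,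
`lintegral_badLen`) `≤ η t + D_N`, where the `susMod`-sections are `susEvent(t')` up to the null set `goodᶜ`
(`≤ η` eventually, uniformly in `t' ≥ Δ_N`, by hypothesis) and
`D_N = ∫_{[0,t]} 𝟙{Δ_N ≤ t'} P{z | (t', z) ∈ iprBad} dt' → 0` by dominated convergence, since for each fixed
`t' > 0` the integrand is `≤ P{ε < ipr(t')} ≤ ε⁻¹ E[ipr(t')] → 0` by H1 (Markov). Finally `P{C' < ∫M} → 0` by H2,
and `η` is free: `limsup P{κ < CellInt} ≤ η t/c₀` for every `η > 0`.
-/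

namespace Summit.AtomisticToContinuum.HydrodynamicLimit.Theorems.SustainedAnisotropy

open scoped BigOperators Topology Classical MeasureTheory ENNReal InnerProductSpace
open Filter Set MeasureTheory
open Literature.Analysis.FluidPDE
open Summit.AtomisticToContinuum.HydrodynamicLimit.Theorems.ContactSourceDuhamel
open Summit.AtomisticToContinuum.HydrodynamicLimit.Theorems.ContactSourceDuhamel.TimeLocal
open Summit.AtomisticToContinuum.HydrodynamicLimit.Theorems.ContactBalance
open Literature.MathematicalPhysics.KineticTheory (hsDiameter hsDiameter_le localGibbsLaw
  isProbabilityMeasure_localGibbsLaw ae_mem_good_localGibbsLaw empiricalDensityField empiricalMomentumField)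

noncomputable section

namespace WindowOfUI

variable {σ : ℝ} {N : ℕ}

/-! ## The bad set of (window end, datum) and the length of its sections -/

/-- The bad set in `ℝ × Cfg N`: sustained anisotropy OR large window ipr (through the modification). -/
def badSet (Φ : Flows σ) (N : ℕ) (φ ψ : ℕ → T3 → ℝ) (Δ a ε lam Cw : ℝ) : Set (ℝ × Cfg N) :=
  susMod Φ N φ ψ Δ a ε lam Cw ∪ iprBad Φ N Δ ε

/-- `badSet` is measurable. -/
theorem measurableSet_badSet (Φ : Flows σ) (hG : (Torus.geometry (Fin 3)).IsHardSphereRegular (hsDiameter σ N))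
    {φ ψ : ℕ → T3 → ℝ} (hφc : Continuous (φ N)) (hψc : Continuous (ψ N)) (Δ a ε lam Cw : ℝ) :
    MeasurableSet (badSet Φ N φ ψ Δ a ε lam Cw) :=
  (measurableSet_susMod Φ hG hφc hψc Δ a ε lam Cw).union (measurableSet_iprBad Φ hG Δ ε)

/-- The LENGTH OF THE BAD WINDOW ENDS of a datum: `L(z) = λ{t' ∈ [Δ, t] | (t', z) ∈ S}`, as a Lebesgue integral
(so that Tonelli applies verbatim). -/
def badLen (S : Set (ℝ × Cfg N)) (Δ t : ℝ) (z : Cfg N) : ℝ≥0∞ :=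
  ∫⁻ t' in Icc Δ t, S.indicator 1 (t', z)

/-- `badLen` is the volume of the section. -/
theorem badLen_eq {S : Set (ℝ × Cfg N)} (hS : MeasurableSet S) (Δ t : ℝ) (z : Cfg N) :
    badLen S Δ t z = volume ({t' : ℝ | (t', z) ∈ S} ∩ Icc Δ t) := by
  unfold badLen
  have h : (fun t' : ℝ => S.indicator (1 : ℝ × Cfg N → ℝ≥0∞) (t', z)) = {t' : ℝ | (t', z) ∈ S}.indicator 1 := by
    funext t'
    simp only [Set.indicator, mem_setOf_eq, Pi.one_apply]
  rw [h, lintegral_indicator_one (measurableSet_section_left hS z),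
    Measure.restrict_apply (measurableSet_section_left hS z)]

/-- `badLen` is measurable in the datum. -/
theorem measurable_badLen {S : Set (ℝ × Cfg N)} (hS : MeasurableSet S) (Δ t : ℝ) :
    Measurable (badLen S Δ t) := by
  unfold badLen
  exact (measurable_one.indicator hS).lintegral_prod_left'

/-- TONELLI: `E[L] = ∫_{[Δ,t]} P{z | (t', z) ∈ S} dt'`. -/
theorem lintegral_badLen {S : Set (ℝ × Cfg N)} (hS : MeasurableSet S) (P : Measure (Cfg N)) [SFinite P]
    (Δ t : ℝ) : ∫⁻ z, badLen S Δ t z ∂P = ∫⁻ t' in Icc Δ t, P {z | (t', z) ∈ S} := by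
  unfold badLen
  have hsw : AEMeasurable (Function.uncurry fun (z : Cfg N) (t' : ℝ) =>
      S.indicator (1 : ℝ × Cfg N → ℝ≥0∞) (t', z)) (P.prod (volume.restrict (Icc Δ t))) :=
    ((measurable_one.indicator hS).comp measurable_swap).aemeasurable
  rw [lintegral_lintegral_swap hsw]
  refine lintegral_congr fun t' => ?_
  have h : (fun z : Cfg N => S.indicator (1 : ℝ × Cfg N → ℝ≥0∞) (t', z)) =
      {z : Cfg N | (t', z) ∈ S}.indicator 1 := by
    funext z
    simp only [Set.indicator, mem_setOf_eq, Pi.one_apply]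
  rw [h, lintegral_indicator_one (measurableSet_section_right hS t')]

/-- MARKOV for the length of the bad window ends. -/
theorem measure_badLen_ge_le {S : Set (ℝ × Cfg N)} (hS : MeasurableSet S) (P : Measure (Cfg N)) [SFinite P]
    {c : ℝ} (hc : 0 < c) (Δ t : ℝ) :
    P {z | ENNReal.ofReal c ≤ badLen S Δ t z} ≤
      (∫⁻ t' in Icc Δ t, P {z | (t', z) ∈ S}) / ENNReal.ofReal c := by
  rw [← lintegral_badLen hS P Δ t]
  exact meas_ge_le_lintegral_div (measurable_badLen hS Δ t).aemeasurable (ENNReal.ofReal_pos.2 hc).ne'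
    ENNReal.ofReal_ne_top

/-! ## Sections of the bad set against the line's events -/

section Sections

variable (Φ : Flows σ) (P : Measure (Cfg N)) (hgood : P (Φ N).goodᶜ = 0)
include hgood

/-- Up to the null set `goodᶜ`, the `t'`-section of `susMod` is the sustained-anisotropy event. -/
theorem measure_susMod_section_le (φ ψ : ℕ → T3 → ℝ) (Δ a ε lam Cw t' : ℝ) :
    P {z | (t', z) ∈ susMod Φ N φ ψ Δ a ε lam Cw} ≤ P (susEvent σ N (Φ N) φ ψ Δ a ε lam Cw t') := by
  have hsub : {z | (t', z) ∈ susMod Φ N φ ψ Δ a ε lam Cw} ⊆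
      susEvent σ N (Φ N) φ ψ Δ a ε lam Cw t' ∪ (Φ N).goodᶜ := by
    intro z hz
    by_cases hg : z ∈ (Φ N).good
    · exact Or.inl ((mem_susEvent_iff_of_mem Φ hg φ ψ Δ a ε lam Cw t').2 hz)
    · exact Or.inr hg
  calc P {z | (t', z) ∈ susMod Φ N φ ψ Δ a ε lam Cw}
      ≤ P (susEvent σ N (Φ N) φ ψ Δ a ε lam Cw t' ∪ (Φ N).goodᶜ) := measure_mono hsub
    _ ≤ P (susEvent σ N (Φ N) φ ψ Δ a ε lam Cw t') + P (Φ N).goodᶜ := measure_union_le _ _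
    _ = P (susEvent σ N (Φ N) φ ψ Δ a ε lam Cw t') := by rw [hgood, add_zero]

/-- Up to the null set `goodᶜ`, the `t'`-section of `iprBad` is the event `ε < ipr(t')`. -/
theorem measure_iprBad_section_le (Δ ε t' : ℝ) :
    P {z | (t', z) ∈ iprBad Φ N Δ ε} ≤ P {z | ε < iprF σ N ((Φ N).flow (t' - Δ) z) Δ} := by
  have hsub : {z | (t', z) ∈ iprBad Φ N Δ ε} ⊆
      {z | ε < iprF σ N ((Φ N).flow (t' - Δ) z) Δ} ∪ (Φ N).goodᶜ := by
    intro z hz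
    by_cases hg : z ∈ (Φ N).good
    · left
      simp only [iprBad, mem_setOf_eq] at hz ⊢
      rwa [iprF_eq_of_mem Φ hg]
    · exact Or.inr hg
  calc P {z | (t', z) ∈ iprBad Φ N Δ ε}
      ≤ P ({z | ε < iprF σ N ((Φ N).flow (t' - Δ) z) Δ} ∪ (Φ N).goodᶜ) := measure_mono hsub
    _ ≤ P {z | ε < iprF σ N ((Φ N).flow (t' - Δ) z) Δ} + P (Φ N).goodᶜ := measure_union_le _ _
    _ = P {z | ε < iprF σ N ((Φ N).flow (t' - Δ) z) Δ} := by rw [hgood, add_zero]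

/-- The `t'`-section of the bad set: `P ≤ P(susEvent t') + P{z | (t', z) ∈ iprBad}`. -/
theorem measure_badSet_section_le (φ ψ : ℕ → T3 → ℝ) (Δ a ε lam Cw t' : ℝ) :
    P {z | (t', z) ∈ badSet Φ N φ ψ Δ a ε lam Cw} ≤
      P (susEvent σ N (Φ N) φ ψ Δ a ε lam Cw t') + P {z | (t', z) ∈ iprBad Φ N Δ ε} :=
  calc P {z | (t', z) ∈ badSet Φ N φ ψ Δ a ε lam Cw}
      ≤ P ({z | (t', z) ∈ susMod Φ N φ ψ Δ a ε lam Cw} ∪ {z | (t', z) ∈ iprBad Φ N Δ ε}) :=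
        measure_mono fun _ hz => hz
    _ ≤ P {z | (t', z) ∈ susMod Φ N φ ψ Δ a ε lam Cw} + P {z | (t', z) ∈ iprBad Φ N Δ ε} :=
        measure_union_le _ _
    _ ≤ _ := add_le_add (measure_susMod_section_le Φ P hgood φ ψ Δ a ε lam Cw t') le_rfl

end Sections

end WindowOfUI

/-! ## The stub -/

open WindowOfUI in
/-- **`stub_windowOfUI`** (registered signature verbatim; the reshaped `WindowOfUIStub` of the line lead): from the
per-window smallness of the sustained-anisotropy events, H1, H2 and the UI bound to `CellInt → 0` in probability.
See the module docstring for the proof. (`0 < γ`, `γ ≤ 1/15` are not used: `CellUIBound` has digested them.) -/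
theorem stub_windowOfUI : ∀ (a₀ θ₀ : T3 → ℝ) (u₀ : T3 → V3), NiceProfiles a₀ θ₀ u₀ →
    ∀ σ : ℝ, 0 < σ → σ < 2⁻¹ → ∀ Φ : Flows σ, DiffuseAt σ a₀ θ₀ u₀ Φ →
      ∀ (γ C : ℝ) (φ : ℕ → T3 → ℝ), 0 < γ → γ ≤ 1 / 15 → AdmissibleKernel γ C φ →
        ∀ (ψ : ℕ → T3 → ℝ) (ℓ : ℕ → ℝ), CellKernel ψ ℓ → CellUIBound φ ψ σ → ∀ Δ : ℕ → ℝ, Window Δ →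
          ∀ t : ℝ, 0 < t → TailsOn σ a₀ θ₀ u₀ Φ t →
            (∀ (a lam Cw : ℝ), 0 < a → 0 < lam → 0 < Cw → ∃ ε : ℝ, 0 < ε ∧ ∀ η : ℝ, 0 < η →
                ∀ᶠ N : ℕ in atTop, ∀ t' : ℝ, Δ N ≤ t' →
                  localGibbsLaw σ a₀ u₀ θ₀ N (Φ N) (susEvent σ N (Φ N) φ ψ (Δ N) a ε lam Cw t') ≤
                    ENNReal.ofReal η) →
              ∀ κ : ℝ, 0 < κ →
                Tendsto (fun N : ℕ => localGibbsLaw σ a₀ u₀ θ₀ N (Φ N) {z | κ < CellInt σ N (Φ N) φ ψ t z})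
                  atTop (𝓝 0) := by
  intro a₀ θ₀ u₀ hnice σ hσ hσ2 Φ hD γ C φ _hγ _hγ' hadm ψ ℓ hcell hUI Δ hwin t ht hT hS κ hκ
  -- standing facts about the local Gibbs laws and the geometry
  have hσ2' : σ ≤ 1 / 2 := by rw [one_div]; exact hσ2.le
  have hPprob : ∀ N, IsProbabilityMeasure (localGibbsLaw σ a₀ u₀ θ₀ N (Φ N)) := fun N =>
    isProbabilityMeasure_localGibbsLaw hnice.1 hnice.2.1 hnice.2.2.1 hnice.2.2.2.1 hnice.2.2.2.2 hσ2' N (Φ N)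
  have hgood : ∀ N, localGibbsLaw σ a₀ u₀ θ₀ N (Φ N) (Φ N).goodᶜ = 0 := fun N =>
    ae_iff.1 (ae_mem_good_localGibbsLaw σ a₀ u₀ θ₀ N (Φ N))
  have hG : ∀ N, (Torus.geometry (Fin 3)).IsHardSphereRegular (hsDiameter σ N) := fun N =>
    Torus.isHardSphereRegular_geometry ((hsDiameter_le hσ.le N).trans_lt hσ2)
  have hφc : ∀ N, Continuous (φ N) := fun N => (hadm.1 N).continuous
  have hψc : ∀ N, Continuous (ψ N) := fun N => hcell.1 N
  -- H2: `P{C' < ∫₀ᵗ M} → 0` with `C' = max Cexp 1 > 0`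
  obtain ⟨lam, Cexp, hlam, hT⟩ := hT
  have hC'0 : 0 < max Cexp 1 := lt_of_lt_of_le one_pos (le_max_right _ _)
  have hTail : Tendsto (fun N => localGibbsLaw σ a₀ u₀ θ₀ N (Φ N) {z | max Cexp 1 < ∫ s in Icc 0 t,
      PastDamping.expMoment lam N ((Φ N).flow s z)}) atTop (𝓝 0) := by
    refine tendsto_of_tendsto_of_tendsto_of_le_of_le tendsto_const_nhds hT (fun _ => zero_le)
      fun N => measure_mono fun z hz => ?_
    simp only [mem_setOf_eq] at hz ⊢
    rw [tailsIntegral_eq]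
    exact lt_of_le_of_lt (le_max_left _ _) hz
  -- the UI bound with a nonnegative constant `K₁ = max K₁' 0`
  obtain ⟨K₁', N₀, hUI'⟩ := hUI
  have hK₁0 : 0 ≤ max K₁' 0 := le_max_right _ _
  have hUIK : ∀ N, N₀ ≤ N → ∀ z' ∈ hardSphereDomain (Torus.geometry (Fin 3)) (N + 1) (hsDiameter σ N),
      cellF N φ ψ z' ≤ max K₁' 0 * (((N + 1 : ℕ) : ℝ)⁻¹ * ∑ j : Fin (N + 1), (1 + ‖(z' j).2‖ ^ 6)) := by
    intro N hN z' hz'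
    have hpos : 0 ≤ ((N + 1 : ℕ) : ℝ)⁻¹ * ∑ j : Fin (N + 1), (1 + ‖(z' j).2‖ ^ 6) := by positivity
    exact (hUI' N hN z' hz').trans (mul_le_mul_of_nonneg_right (le_max_left _ _) hpos)
  -- constants: cut-off `V`, tail cap `Cw`, level `a`, then `ε` from the per-window smallness
  obtain ⟨V, hV, hVb⟩ := exists_cutoff (max K₁' 0) (max Cexp 1) hlam hκ
  obtain ⟨Cw, hCw, hCwb⟩ := exists_tailCap (cA (max K₁' 0) V) (max Cexp 1) hκ
  have ha0 : 0 < κ / (8 * t) := by positivity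
  obtain ⟨ε, hε, hSε⟩ := hS (κ / (8 * t)) lam Cw ha0 hlam hCw
  have hA : 0 ≤ cA (max K₁' 0) V := cA_nonneg hK₁0 V
  have hβ : 0 ≤ cβ (max K₁' 0) lam V := cβ_nonneg hK₁0 hlam hV
  set Amax : ℝ := cA (max K₁' 0) V + cβ (max K₁' 0) lam V * Cw + 1 with hAmax
  have hAmax0 : 0 < Amax := by positivity
  have hc₀0 : 0 < κ / (2 * Amax) := by positivity
  -- the integrand of H1 after Tonelli: `g N t' = 𝟙{Δ N ≤ t'} P{z | (t', z) ∈ iprBad}`; `∫_{[0,t]} g N → 0`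
  set g : ℕ → ℝ → ℝ≥0∞ := fun N => (Ici (Δ N)).indicator fun t' =>
    localGibbsLaw σ a₀ u₀ θ₀ N (Φ N) {z | (t', z) ∈ iprBad Φ N (Δ N) ε} with hg
  have hgD : Tendsto (fun N => ∫⁻ t' in Icc 0 t, g N t') atTop (𝓝 0) := by
    refine tendsto_setLIntegral_of_le_one (fun N => ?_) (fun N t' => ?_) (fun t' => ?_) t
    · haveI := hPprob N
      exact (measurable_measure_prodMk_left (measurableSet_iprBad Φ (hG N) (Δ N) ε)).indicator
        measurableSet_Ici
    · haveI := hPprob N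
      exact Set.indicator_apply_le' (fun _ => prob_le_one) (fun _ => zero_le_one)
    · rcases le_or_gt t' 0 with ht' | ht'
      · have h0 : ∀ N, g N t' = 0 := fun N =>
          Set.indicator_of_notMem (fun h : t' ∈ Ici (Δ N) => (not_le.2 (lt_of_le_of_lt ht' (hwin.1 N))) h) _
        simp only [h0]
        exact tendsto_const_nhds
      · have hlim : Tendsto (fun N => (∫⁻ z, ENNReal.ofReal (iprF σ N ((Φ N).flow (t' - Δ N) z) (Δ N))
            ∂(localGibbsLaw σ a₀ u₀ θ₀ N (Φ N))) / ENNReal.ofReal ε) atTop (𝓝 0) := by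
          have h := ENNReal.Tendsto.div_const (hD Δ hwin.1 hwin.2.1 hwin.2.2 t' ht') (b := ENNReal.ofReal ε)
            (Or.inr (ENNReal.ofReal_pos.2 hε).ne')
          simpa only [ENNReal.zero_div] using h
        refine tendsto_of_tendsto_of_tendsto_of_le_of_le tendsto_const_nhds hlim (fun _ => zero_le)
          fun N => ?_
        calc g N t' ≤ localGibbsLaw σ a₀ u₀ θ₀ N (Φ N) {z | (t', z) ∈ iprBad Φ N (Δ N) ε} :=
              Set.indicator_le_self _ _ t'
          _ ≤ localGibbsLaw σ a₀ u₀ θ₀ N (Φ N) {z | ε < iprF σ N ((Φ N).flow (t' - Δ N) z) (Δ N)} :=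
              measure_iprBad_section_le Φ _ (hgood N) (Δ N) ε t'
          _ ≤ _ := measure_ipr_gt_le Φ (hG N) _ hε (Δ N) t'
  -- eventual conditions on `N`
  have hev1 : ∀ᶠ N in atTop, N₀ ≤ N := eventually_ge_atTop N₀
  have hev2 : ∀ᶠ N in atTop, Δ N ≤ t := (hwin.2.1.eventually (Iic_mem_nhds ht)).mono fun N h => h
  have hev3 : ∀ᶠ N in atTop, 2 * cA (max K₁' 0) V * Δ N ≤ κ / 8 := by
    have h : Tendsto (fun N => 2 * cA (max K₁' 0) V * Δ N) atTop (𝓝 (2 * cA (max K₁' 0) V * 0)) :=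
      hwin.2.1.const_mul (2 * cA (max K₁' 0) V)
    rw [mul_zero] at h
    exact ((tendsto_order.1 h).2 (κ / 8) (by positivity)).mono fun N h => h.le
  -- MAIN BOUND: for every `η > 0`, eventually
  --   `P{κ < CellInt} ≤ P{C' < ∫M} + (ofReal (η t) + ∫_{[0,t]} g N) / ofReal c₀`
  have hmain : ∀ η : ℝ, 0 < η → ∀ᶠ N in atTop,
      localGibbsLaw σ a₀ u₀ θ₀ N (Φ N) {z | κ < CellInt σ N (Φ N) φ ψ t z} ≤
        localGibbsLaw σ a₀ u₀ θ₀ N (Φ N) {z | max Cexp 1 < ∫ s in Icc 0 t,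
            PastDamping.expMoment lam N ((Φ N).flow s z)} +
          (ENNReal.ofReal (η * t) + ∫⁻ t' in Icc 0 t, g N t') / ENNReal.ofReal (κ / (2 * Amax)) := by
    intro η hη
    filter_upwards [hev1, hev2, hev3, hSε η hη] with N hN1 hN2 hN3 hN4
    haveI := hPprob N
    have hSm : MeasurableSet (badSet Φ N φ ψ (Δ N) (κ / (8 * t)) ε lam Cw) :=
      measurableSet_badSet Φ (hG N) (hφc N) (hψc N) (Δ N) (κ / (8 * t)) ε lam Cw
    -- (i) the event is covered by `goodᶜ ∪ {C' < ∫M} ∪ {c₀ ≤ L}`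
    have hcover : {z | κ < CellInt σ N (Φ N) φ ψ t z} ⊆
        ((Φ N).goodᶜ ∪ {z | max Cexp 1 < ∫ s in Icc 0 t, PastDamping.expMoment lam N ((Φ N).flow s z)}) ∪
          {z | ENNReal.ofReal (κ / (2 * Amax)) ≤
            badLen (badSet Φ N φ ψ (Δ N) (κ / (8 * t)) ε lam Cw) (Δ N) t z} := by
      intro z hz
      by_contra hnot
      simp only [mem_union, mem_compl_iff, mem_setOf_eq, not_or, not_not, not_lt, not_le] at hnot
      obtain ⟨⟨hzg, hzM⟩, hzL⟩ := hnot
      have hdet := cellInt_le_orbit Φ (hG N) (hφc N) (hψc N) hK₁0 (hUIK N hN1) hlam hV (hwin.1 N) hN2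
        hzg hzM (a := κ / (8 * t)) (ε := ε) ha0.le hCw
      set Lr : ℝ := volume.real ({t' : ℝ | (t', z) ∈ susMod Φ N φ ψ (Δ N) (κ / (8 * t)) ε lam Cw ∪
        iprBad Φ N (Δ N) ε} ∩ Icc (Δ N) t) with hLr_def
      have hLr : Lr = (badLen (badSet Φ N φ ψ (Δ N) (κ / (8 * t)) ε lam Cw) (Δ N) t z).toReal := by
        rw [hLr_def, badLen_eq hSm]
        rfl
      have hLr0 : 0 ≤ Lr := measureReal_nonneg
      have hE : κ < CellInt σ N (Φ N) φ ψ t z := hz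
      have h1 : κ / (8 * t) * t = κ / 8 := by field_simp
      have h2 : cA (max K₁' 0) V * (2 * Δ N + max Cexp 1 / Cw) ≤ κ / 8 + κ / 8 := by
        have h2a : cA (max K₁' 0) V * (2 * Δ N + max Cexp 1 / Cw) =
            2 * cA (max K₁' 0) V * Δ N + cA (max K₁' 0) V * (max Cexp 1 / Cw) := by ring
        rw [h2a]
        exact add_le_add hN3 hCwb
      have h3 : (cA (max K₁' 0) V + cβ (max K₁' 0) lam V * Cw) * Lr ≤ Amax * Lr :=
        mul_le_mul_of_nonneg_right (by linarith) hLr0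
      have hhalf : κ / 2 < Amax * Lr := by linarith [hdet, hVb, h1, h2, h3, hE]
      have hLr_gt : κ / (2 * Amax) < Lr := by
        rw [div_lt_iff₀ (by positivity)]
        nlinarith [hhalf]
      have hlt : ENNReal.ofReal (κ / (2 * Amax)) <
          badLen (badSet Φ N φ ψ (Δ N) (κ / (8 * t)) ε lam Cw) (Δ N) t z :=
        calc ENNReal.ofReal (κ / (2 * Amax)) < ENNReal.ofReal Lr :=
              (ENNReal.ofReal_lt_ofReal_iff (hc₀0.trans hLr_gt)).2 hLr_gt
          _ ≤ _ := by rw [hLr]; exact ENNReal.ofReal_toReal_le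
      exact (not_lt.2 hlt.le) hzL
    -- (ii) Tonelli bound of `E[L]`
    have hEL : ∫⁻ t' in Icc (Δ N) t, localGibbsLaw σ a₀ u₀ θ₀ N (Φ N)
        {z | (t', z) ∈ badSet Φ N φ ψ (Δ N) (κ / (8 * t)) ε lam Cw} ≤
          ENNReal.ofReal (η * t) + ∫⁻ t' in Icc 0 t, g N t' := by
      calc ∫⁻ t' in Icc (Δ N) t, localGibbsLaw σ a₀ u₀ θ₀ N (Φ N)
            {z | (t', z) ∈ badSet Φ N φ ψ (Δ N) (κ / (8 * t)) ε lam Cw}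
          ≤ ∫⁻ t' in Icc (Δ N) t, (ENNReal.ofReal η + g N t') := by
            refine setLIntegral_mono' measurableSet_Icc fun t' ht' => ?_
            have hgt : g N t' = localGibbsLaw σ a₀ u₀ θ₀ N (Φ N) {z | (t', z) ∈ iprBad Φ N (Δ N) ε} :=
              Set.indicator_of_mem (ht'.1 : t' ∈ Ici (Δ N)) _
            rw [hgt]
            exact (measure_badSet_section_le Φ _ (hgood N) φ ψ (Δ N) (κ / (8 * t)) ε lam Cw t').trans
              (add_le_add (hN4 t' ht'.1) le_rfl)
        _ = ENNReal.ofReal η * volume (Icc (Δ N) t) + ∫⁻ t' in Icc (Δ N) t, g N t' := by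
            rw [lintegral_add_left measurable_const, setLIntegral_const]
        _ ≤ ENNReal.ofReal (η * t) + ∫⁻ t' in Icc 0 t, g N t' := by
            refine add_le_add ?_ (lintegral_mono_set (Icc_subset_Icc_left (hwin.1 N).le))
            rw [Real.volume_Icc, ← ENNReal.ofReal_mul hη.le]
            exact ENNReal.ofReal_le_ofReal (mul_le_mul_of_nonneg_left (by linarith [hwin.1 N]) hη.le)
    -- (iii) the measure bound
    calc localGibbsLaw σ a₀ u₀ θ₀ N (Φ N) {z | κ < CellInt σ N (Φ N) φ ψ t z}
        ≤ localGibbsLaw σ a₀ u₀ θ₀ N (Φ N) (((Φ N).goodᶜ ∪ {z | max Cexp 1 < ∫ s in Icc 0 t,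
            PastDamping.expMoment lam N ((Φ N).flow s z)}) ∪
            {z | ENNReal.ofReal (κ / (2 * Amax)) ≤
              badLen (badSet Φ N φ ψ (Δ N) (κ / (8 * t)) ε lam Cw) (Δ N) t z}) := measure_mono hcover
      _ ≤ localGibbsLaw σ a₀ u₀ θ₀ N (Φ N) (Φ N).goodᶜ +
            localGibbsLaw σ a₀ u₀ θ₀ N (Φ N) {z | max Cexp 1 < ∫ s in Icc 0 t,
              PastDamping.expMoment lam N ((Φ N).flow s z)} +
            localGibbsLaw σ a₀ u₀ θ₀ N (Φ N) {z | ENNReal.ofReal (κ / (2 * Amax)) ≤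
              badLen (badSet Φ N φ ψ (Δ N) (κ / (8 * t)) ε lam Cw) (Δ N) t z} :=
          (measure_union_le _ _).trans (add_le_add (measure_union_le _ _) le_rfl)
      _ ≤ 0 + localGibbsLaw σ a₀ u₀ θ₀ N (Φ N) {z | max Cexp 1 < ∫ s in Icc 0 t,
              PastDamping.expMoment lam N ((Φ N).flow s z)} +
            (∫⁻ t' in Icc (Δ N) t, localGibbsLaw σ a₀ u₀ θ₀ N (Φ N)
              {z | (t', z) ∈ badSet Φ N φ ψ (Δ N) (κ / (8 * t)) ε lam Cw}) / ENNReal.ofReal (κ / (2 * Amax)) :=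
          add_le_add (add_le_add (hgood N).le le_rfl) (measure_badLen_ge_le hSm _ hc₀0 (Δ N) t)
      _ ≤ _ := by
          rw [zero_add]
          exact add_le_add le_rfl (ENNReal.div_le_div_right hEL _)
  -- CONCLUSION
  rw [ENNReal.tendsto_nhds_zero]
  intro e he
  rcases eq_or_ne e ⊤ with rfl | hetop
  · exact Eventually.of_forall fun N => le_top
  have he3 : 0 < e / 3 := ENNReal.div_pos he.ne' (by norm_num)
  have he3top : e / 3 ≠ ⊤ := ENNReal.div_ne_top hetop (by norm_num)
  have hr0 : 0 < (e / 3).toReal := ENNReal.toReal_pos he3.ne' he3top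
  -- `η` with `ofReal (η t) / ofReal c₀ ≤ e / 3`
  set η : ℝ := (e / 3).toReal * (κ / (2 * Amax)) / t with hη
  have hη0 : 0 < η := by positivity
  have hηt : ENNReal.ofReal (η * t) / ENNReal.ofReal (κ / (2 * Amax)) ≤ e / 3 := by
    have h1 : η * t = (e / 3).toReal * (κ / (2 * Amax)) := by
      rw [hη]
      field_simp
    rw [h1, ENNReal.ofReal_mul hr0.le, ENNReal.mul_div_cancel_right (ENNReal.ofReal_pos.2 hc₀0).ne'
      ENNReal.ofReal_ne_top]
    exact ENNReal.ofReal_toReal_le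
  have hA1 := ENNReal.tendsto_nhds_zero.1 hTail (e / 3) he3
  have hgD' : Tendsto (fun N => (∫⁻ t' in Icc 0 t, g N t') / ENNReal.ofReal (κ / (2 * Amax))) atTop (𝓝 0) := by
    have h := ENNReal.Tendsto.div_const hgD (b := ENNReal.ofReal (κ / (2 * Amax)))
      (Or.inr (ENNReal.ofReal_pos.2 hc₀0).ne')
    simpa only [ENNReal.zero_div] using h
  have hA3 := ENNReal.tendsto_nhds_zero.1 hgD' (e / 3) he3
  filter_upwards [hmain η hη0, hA1, hA3] with N h1 h2 h3
  calc localGibbsLaw σ a₀ u₀ θ₀ N (Φ N) {z | κ < CellInt σ N (Φ N) φ ψ t z}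
      ≤ localGibbsLaw σ a₀ u₀ θ₀ N (Φ N) {z | max Cexp 1 < ∫ s in Icc 0 t,
            PastDamping.expMoment lam N ((Φ N).flow s z)} +
          (ENNReal.ofReal (η * t) + ∫⁻ t' in Icc 0 t, g N t') / ENNReal.ofReal (κ / (2 * Amax)) := h1
    _ = localGibbsLaw σ a₀ u₀ θ₀ N (Φ N) {z | max Cexp 1 < ∫ s in Icc 0 t,
            PastDamping.expMoment lam N ((Φ N).flow s z)} +
          ENNReal.ofReal (η * t) / ENNReal.ofReal (κ / (2 * Amax)) +
          (∫⁻ t' in Icc 0 t, g N t') / ENNReal.ofReal (κ / (2 * Amax)) := by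
        rw [ENNReal.add_div, add_assoc]
    _ ≤ e / 3 + e / 3 + e / 3 := add_le_add_three h2 hηt h3
    _ = e := ENNReal.add_thirds e

end

end Summit.AtomisticToContinuum.HydrodynamicLimit.Theorems.SustainedAnisotropy
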